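import Summits.AtomisticToContinuum.Crystallization.Theorems.FrustratedLawDichotomyCappedRigidityCertPatterns

/-!
# OverbindingBudget — two-shell coverage, part 1: the DIRECTION lemmas for the fcc and hcp patterns

Helper file (`--supports stmt-AtomisticToContinuum-31280`, lens-3 g29; feeds `OverbindingBudgetTwoShellCover`, which proves the coverage
piece `OverbindingBudgetTwoShellSeam.TwoShellCover (1/100) (3/50) (1/450)` of the two-shell seam).

THE STATEMENT ("`n` is direction-covered by `Pat`", proved for every unit vector `n` and `Pat ∈ {fcc, hcp}` kissing pattern): either some CAP direction is
close — `⟪n, u + v⟫ ≥ 57/50` for a square diagonal `u, v ∈ Pat` (`dist u v = √2`, so `u + v` is the ideal cap, `‖u + v‖ = √2`; angle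
`≤ 36.3°`) — or some FIRST-SHELL direction is close — `⟪n, u⟫ ≥ 4/5` for a `u ∈ Pat` (angle `≤ 36.9°`).  (The deep holes of the twelve kissing
directions are the six square centres, `45°`; they are exactly the cap directions.  Away from the caps the worst direction is a triangle centre,
`35.26°`, inner product `2/√6 ≈ 0.8165 > 4/5`.)

THE PROOF is a symmetry reduction to ONE real inequality (`core`): for `0 ≤ z ≤ y ≤ x`, `x² + y² + z² = 1`, `√2·x < 57/50` one has
`x + y ≥ 4√2/5`.  fcc (cuboctahedron `{(±1,±1,0)}/√2`, caps `{(±2,0,0)}/√2`): sort `|n₀|, |n₁|, |n₂|`; the cap over the largest coordinate or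
the vertex carrying the signs of the two largest.  hcp (anticuboctahedron in the coordinates of `Literature…hcpInt / √18`, mirror plane
`x + y + z = 0`): sort the coordinates; for `n₀ + n₁ + n₂ ≥ 0` the witnesses are the upper cap `(6eᵢ)/√18`, the upper-triangle vertex
`(3eᵢ + 3eⱼ)/√18` or the hexagon vertex `(3eᵢ − 3eₖ)/√18`; for `n₀ + n₁ + n₂ ≤ 0` their mirror images.  All pattern memberships and squared
distances are decided on the integer models.  Nearest in-tree prior art: `PhononSlackCertificatesNearFarGlueR.stub_coverFccSharp` /
`stub_coverHcpSharp` (the twelve first-shell directions `2/3`-cover the sphere, same sign/sort trick); the seam needs the finer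
cap-or-shell alternative proved here (`2/3 < 0.796`, the shell threshold forced by `ε = 3/50`), which is new.
No `sorry`, no new definitions, no new axioms, no `instance` / `notation`.
-/

noncomputable section

namespace Summit.AtomisticToContinuum.Crystallization.Theorems.OverbindingBudgetTwoShellCoverDirections

open scoped RealInnerProductSpace
open Literature.Geometry.DiscreteGeometry
open Summit.AtomisticToContinuum.Crystallization.Theorems.FrustratedLawDichotomyTwoShellRigidityCut (E3)
open Summit.AtomisticToContinuum.Crystallization.Theorems.FrustratedLawDichotomyCappedRigidityCertPatterns
  (dist_eq_sqrt_two_iff_sqNormInt)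

/-! ## §1 Real-arithmetic helpers -/

/-- `√2² = 2`, `1.41421 < √2 < 1.41422`, `(√2)⁻¹ = √2/2`. [folklore] -/
theorem sqrt_two_facts :
    Real.sqrt 2 ^ 2 = 2 ∧ (1.41421 : ℝ) < Real.sqrt 2 ∧ Real.sqrt 2 < 1.41422 ∧ (Real.sqrt 2)⁻¹ = Real.sqrt 2 / 2 := by
  have h : Real.sqrt 2 * Real.sqrt 2 = 2 := Real.mul_self_sqrt (by norm_num)
  have h0 : Real.sqrt 2 ≠ 0 := by
    intro e; rw [e, mul_zero] at h; norm_num at h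
  refine ⟨Real.sq_sqrt (by norm_num), ?_, ?_, ?_⟩
  · rw [Real.lt_sqrt (by norm_num)]; norm_num
  · rw [Real.sqrt_lt' (by norm_num)]; norm_num
  · rw [eq_div_iff two_ne_zero]
    calc (Real.sqrt 2)⁻¹ * 2 = (Real.sqrt 2)⁻¹ * (Real.sqrt 2 * Real.sqrt 2) := by rw [h]
      _ = Real.sqrt 2 := by rw [← mul_assoc, inv_mul_cancel₀ h0, one_mul]

/-- `√(2 : ℕ) = √2`. [folklore] -/
theorem sqrt_two_cast : Real.sqrt ((2 : ℕ) : ℝ) = Real.sqrt 2 := by norm_num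

/-- **THE CORE INEQUALITY.**  `0 ≤ z ≤ y ≤ x`, `x² + y² + z² = 1`, `√2·x < 57/50` ⟹ `x + y ≥ 4√2/5`.
(`y ≥ √((1 − x²)/2)` and `x ∈ [1/√3, 0.8061]`; equality side `x + y = 2/√3 ≈ 1.1547` at the triangle centre vs `4√2/5 ≈ 1.1314`.) [folklore] -/
theorem core {x y z : ℝ} (hz : 0 ≤ z) (hzy : z ≤ y) (hyx : y ≤ x) (h1 : x ^ 2 + y ^ 2 + z ^ 2 = 1)
    (hB : Real.sqrt 2 * x < 57 / 50) : 4 * Real.sqrt 2 / 5 ≤ x + y := by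
  obtain ⟨ht, htl, htu, -⟩ := sqrt_two_facts
  have hy0 : 0 ≤ y := hz.trans hzy
  have hzz : z ^ 2 ≤ y ^ 2 := pow_le_pow_left₀ hz hzy 2
  have hyy : y ^ 2 ≤ x ^ 2 := pow_le_pow_left₀ hy0 hyx 2
  have hx1 : (0.5773 : ℝ) ≤ x := by nlinarith
  have hx2 : x ≤ 0.80611 := by nlinarith
  set c := 4 * Real.sqrt 2 / 5 with hc
  have hc1 : (1.131368 : ℝ) ≤ c := by rw [hc]; linarith
  have hc2 : c ^ 2 = 32 / 25 := by rw [hc, div_pow, mul_pow, ht]; norm_num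
  by_contra hlt
  have hlt' : y < c - x := by linarith
  have hsq : y ^ 2 < (c - x) ^ 2 := pow_lt_pow_left₀ hlt' hy0 (by norm_num)
  nlinarith [mul_nonneg (sub_nonneg.2 hx1) (sub_nonneg.2 hx2)]

/-- **hcp arithmetic core.**  `r ≤ q ≤ p`, `p + q + r ≥ 0`, `p² + q² + r² = 1` ⟹ `√2·p ≥ 57/50` or `p + q ≥ 4√2/5` or `p − r ≥ 4√2/5`
(upper cap / upper-triangle vertex / hexagon vertex). [folklore] -/
theorem hcp_core {p q r : ℝ} (hrq : r ≤ q) (hqp : q ≤ p) (hs : 0 ≤ p + q + r) (h1 : p ^ 2 + q ^ 2 + r ^ 2 = 1) :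
    (57 : ℝ) / 50 ≤ Real.sqrt 2 * p ∨ 4 * Real.sqrt 2 / 5 ≤ p + q ∨ 4 * Real.sqrt 2 / 5 ≤ p - r := by
  obtain ⟨ht, htl, htu, -⟩ := sqrt_two_facts
  by_cases hA : (57 : ℝ) / 50 ≤ Real.sqrt 2 * p
  · exact Or.inl hA
  have hA := not_le.1 hA
  right
  by_cases hqr : 0 ≤ q + r
  · left
    have hrabs : |r| ≤ q := abs_le.2 ⟨by linarith, hrq⟩
    exact core (abs_nonneg r) hrabs hqp (by rw [sq_abs]; exact h1) hA
  · right
    have hqr := not_le.1 hqr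
    have hr0 : r < 0 := by linarith
    have hqd : |q| ≤ -r := abs_le.2 ⟨by linarith, by linarith⟩
    have hqp' : |q| ≤ p := abs_le.2 ⟨by linarith, hqp⟩
    have h1' : (-r) ^ 2 + p ^ 2 + |q| ^ 2 = 1 := by rw [sq_abs]; linarith [h1, neg_sq r]
    have h1'' : p ^ 2 + (-r) ^ 2 + |q| ^ 2 = 1 := by linarith
    by_cases hD : (57 : ℝ) / 50 ≤ Real.sqrt 2 * (-r)
    · have h2p : -r ≤ 2 * p := by linarith
      nlinarith
    · have hD := not_le.1 hD
      rcases le_total p (-r) with hpd | hdp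
      · have := core (abs_nonneg q) hqp' hpd h1' hD
        linarith
      · have := core (abs_nonneg q) hqd hdp h1'' hA
        linarith


/-- Unit vectors: `n₀² + n₁² + n₂² = 1`. [folklore] -/
theorem sum_sq_eq_one {n : E3} (hn : ‖n‖ = 1) : n 0 ^ 2 + n 1 ^ 2 + n 2 ^ 2 = 1 := by
  have h2 : ‖n‖ ^ 2 = n 0 ^ 2 + n 1 ^ 2 + n 2 ^ 2 := by
    rw [PiLp.norm_sq_eq_of_L2, Fin.sum_univ_three]
    simp [Real.norm_eq_abs, sq_abs]
  rw [hn] at h2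
  linarith

/-- Inner product with a scaled integer vector, as a coordinate sum. [folklore] -/
theorem inner_smul_intVec (n : E3) (c : ℝ) (v : Fin 3 → ℤ) :
    ⟪n, c • intVec v⟫ = c * ∑ l : Fin 3, (v l : ℝ) * n l := by
  rw [real_inner_smul_right]
  congr 1

/-- Coordinate sum against `single i s + single j t`. [folklore] -/
theorem sum_single_add_single (n : E3) (i j : Fin 3) (s t : ℤ) :
    ∑ l : Fin 3, ((Pi.single i s + Pi.single j t : Fin 3 → ℤ) l : ℝ) * n l = s * n i + t * n j := by
  simp [Pi.single_apply, add_mul, Finset.sum_add_distrib]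

/-- Coordinate sum against `a • single i 1`. [folklore] -/
theorem sum_smul_single (n : E3) (i : Fin 3) (a : ℤ) :
    ∑ l : Fin 3, ((a • Pi.single i (1 : ℤ) : Fin 3 → ℤ) l : ℝ) * n l = a * n i := by
  simp [Pi.single_apply]

/-- Coordinate sum against a constant vector. [folklore] -/
theorem sum_const_vec (n : E3) (a : ℤ) :
    ∑ l : Fin 3, ((fun _ => a : Fin 3 → ℤ) l : ℝ) * n l = a * (n 0 + n 1 + n 2) := by
  simp [Fin.sum_univ_three]; ring

/-! ## §2 The fcc pattern -/

/-- Integer model: `s·eᵢ + t·eⱼ ∈ fccInt` for `i ≠ j`, `s, t ∈ {±1}`. [folklore] -/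
theorem fccInt_single_add_single (i j : Fin 3) (hij : i ≠ j) (s t : ℤ) (hs : s = 1 ∨ s = -1) (ht : t = 1 ∨ t = -1) :
    (Pi.single i s + Pi.single j t : Fin 3 → ℤ) ∈ fccInt := by
  rcases hs with rfl | rfl <;> rcases ht with rfl | rfl <;> revert hij <;> revert i j <;> decide

/-- Integer model: `|(s·eᵢ + eⱼ) − (s·eᵢ − eⱼ)|² = 4`. [folklore] -/
theorem fccInt_sqNorm_diag (i j : Fin 3) (hij : i ≠ j) (s : ℤ) (hs : s = 1 ∨ s = -1) :
    sqNormInt ((Pi.single i s + Pi.single j 1 : Fin 3 → ℤ) - (Pi.single i s + Pi.single j (-1))) = 2 * ((2 : ℕ) : ℤ) := by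
  rcases hs with rfl | rfl <;> revert hij <;> revert i j <;> decide

/-- Membership of a scaled integer vector in the fcc kissing pattern. [folklore] -/
theorem mem_fcc_of_mem_fccInt {v : Fin 3 → ℤ} (hv : v ∈ fccInt) :
    ((Real.sqrt ((2 : ℕ) : ℝ))⁻¹ • intVec v : E3) ∈ fccKissingPattern := by
  simp only [fccKissingPattern, scaledPattern, Finset.mem_image]
  exact ⟨v, hv, rfl⟩

/-- **fcc shell witness**: for `i ≠ j`, `s, t ∈ {±1}` the pattern point `(s·eᵢ + t·eⱼ)/√2` has `⟪n, ·⟫ = (s·nᵢ + t·nⱼ)/√2`. [folklore] -/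
theorem fcc_shell_witness (n : E3) (i j : Fin 3) (hij : i ≠ j) (s t : ℤ) (hs : s = 1 ∨ s = -1) (ht : t = 1 ∨ t = -1) :
    ∃ u ∈ fccKissingPattern, ⟪n, u⟫ = ((s : ℝ) * n i + t * n j) / Real.sqrt 2 := by
  refine ⟨_, mem_fcc_of_mem_fccInt (fccInt_single_add_single i j hij s t hs ht), ?_⟩
  rw [inner_smul_intVec, sum_single_add_single, sqrt_two_cast, inv_mul_eq_div]

/-- **fcc cap witness**: for `i ≠ j`, `s ∈ {±1}` the diagonal `(s·eᵢ ± eⱼ)/√2` has sum `√2·s·eᵢ`, `⟪n, ·⟫ = √2·s·nᵢ`. [folklore] -/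
theorem fcc_cap_witness (n : E3) (i j : Fin 3) (hij : i ≠ j) (s : ℤ) (hs : s = 1 ∨ s = -1) :
    ∃ u ∈ fccKissingPattern, ∃ v ∈ fccKissingPattern, dist u v = Real.sqrt 2 ∧ ⟪n, u + v⟫ = Real.sqrt 2 * (s * n i) := by
  refine ⟨_, mem_fcc_of_mem_fccInt (fccInt_single_add_single i j hij s 1 hs (Or.inl rfl)), _,
    mem_fcc_of_mem_fccInt (fccInt_single_add_single i j hij s (-1) hs (Or.inr rfl)),
    (dist_eq_sqrt_two_iff_sqNormInt two_ne_zero _ _).2 (fccInt_sqNorm_diag i j hij s hs), ?_⟩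
  obtain ⟨-, -, -, hinv⟩ := sqrt_two_facts
  rw [inner_add_right, inner_smul_intVec, inner_smul_intVec, sum_single_add_single, sum_single_add_single, sqrt_two_cast, hinv]
  push_cast
  ring

/-- **fcc, sorted coordinates**: if `|n k| ≤ |n j| ≤ |n i|` (`i, j, k` distinct) then `n` is direction-covered by the fcc pattern. [this file] -/
theorem fcc_dir_of_order (n : E3) (i j k : Fin 3) (hij : i ≠ j)
    (h1 : n i ^ 2 + n j ^ 2 + n k ^ 2 = 1) (hkj : |n k| ≤ |n j|) (hji : |n j| ≤ |n i|) :
    ((∃ u ∈ fccKissingPattern, ∃ v ∈ fccKissingPattern, dist u v = Real.sqrt 2 ∧ (57 : ℝ) / 50 ≤ ⟪n, u + v⟫) ∨ (∃ u ∈ fccKissingPattern, (4 : ℝ) / 5 ≤ ⟪n, u⟫)) := by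
  obtain ⟨ht, htl, -, -⟩ := sqrt_two_facts
  have ht0 : 0 < Real.sqrt 2 := by linarith
  -- signs `s, t ∈ {±1}` with `s·nᵢ = |nᵢ|`, `t·nⱼ = |nⱼ|` (cf. `PhononSlackCertificatesNearFarGlueR.coverFcc_sign`)
  have hsgn : ∀ a : ℝ, ∃ s : ℤ, (s = 1 ∨ s = -1) ∧ (s : ℝ) * a = |a| := fun a => by
    rcases le_total 0 a with h | h
    · exact ⟨1, Or.inl rfl, by rw [abs_of_nonneg h]; simp⟩
    · exact ⟨-1, Or.inr rfl, by rw [abs_of_nonpos h]; simp⟩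
  by_cases hA : (57 : ℝ) / 50 ≤ Real.sqrt 2 * |n i|
  · left
    obtain ⟨s, hs, hsa⟩ := hsgn (n i)
    obtain ⟨u, hu, v, hv, huv, hinner⟩ := fcc_cap_witness n i j hij s hs
    refine ⟨u, hu, v, hv, huv, ?_⟩
    rw [hinner, hsa]
    exact hA
  · right
    have hA := not_le.1 hA
    have h1' : |n i| ^ 2 + |n j| ^ 2 + |n k| ^ 2 = 1 := by simpa only [sq_abs] using h1
    have hcore := core (abs_nonneg _) hkj hji h1' hA
    obtain ⟨s, hs, hsa⟩ := hsgn (n i)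
    obtain ⟨t, ht', hta⟩ := hsgn (n j)
    obtain ⟨u, hu, hinner⟩ := fcc_shell_witness n i j hij s t hs ht'
    refine ⟨u, hu, ?_⟩
    rw [hinner, hsa, hta, le_div_iff₀ ht0]
    linarith

/-- **fcc direction lemma**: every unit vector is direction-covered by the fcc kissing pattern. [this file] -/
theorem fcc_direction (n : E3) (hn : ‖n‖ = 1) : ((∃ u ∈ fccKissingPattern, ∃ v ∈ fccKissingPattern, dist u v = Real.sqrt 2 ∧ (57 : ℝ) / 50 ≤ ⟪n, u + v⟫) ∨ (∃ u ∈ fccKissingPattern, (4 : ℝ) / 5 ≤ ⟪n, u⟫)) := by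
  have hsq := sum_sq_eq_one hn
  rcases le_total |n 0| |n 1| with h01 | h10
  · rcases le_total |n 1| |n 2| with h12 | h21
    · exact fcc_dir_of_order n 2 1 0 (by decide) (by linarith) h01 h12
    · rcases le_total |n 0| |n 2| with h02 | h20
      · exact fcc_dir_of_order n 1 2 0 (by decide) (by linarith) h02 h21
      · exact fcc_dir_of_order n 1 0 2 (by decide) (by linarith) h20 h01
  · rcases le_total |n 1| |n 2| with h12 | h21
    · rcases le_total |n 0| |n 2| with h02 | h20
      · exact fcc_dir_of_order n 2 0 1 (by decide) (by linarith) h10 h02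
      · exact fcc_dir_of_order n 0 2 1 (by decide) (by linarith) h12 h20
    · exact fcc_dir_of_order n 0 1 2 (by decide) (by linarith) h21 h10

/-! ## §3 The hcp pattern -/

/-- Integer model (upper triangle): `3eᵢ + 3eⱼ ∈ hcpInt` for `i ≠ j`. [folklore] -/
theorem hcpInt_tri (i j : Fin 3) (hij : i ≠ j) : (3 • (Pi.single i 1 + Pi.single j 1) : Fin 3 → ℤ) ∈ hcpInt := by
  revert hij; revert i j; decide

/-- Integer model (hexagon): `3eᵢ − 3eⱼ ∈ hcpInt` for `i ≠ j`. [folklore] -/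
theorem hcpInt_hex (i j : Fin 3) (hij : i ≠ j) : (3 • (Pi.single i 1 - Pi.single j 1) : Fin 3 → ℤ) ∈ hcpInt := by
  revert hij; revert i j; decide

/-- Integer model (lower triangle): `3eᵢ + 3eⱼ − 4·(1,1,1) ∈ hcpInt` for `i ≠ j`. [folklore] -/
theorem hcpInt_lowtri (i j : Fin 3) (hij : i ≠ j) :
    (3 • (Pi.single i 1 + Pi.single j 1) - (fun _ => 4) : Fin 3 → ℤ) ∈ hcpInt := by
  revert hij; revert i j; decide

/-- Integer model: the upper square diagonal `3eᵢ + 3eⱼ`, `3eᵢ − 3eⱼ` has `|·|² = 36`. [folklore] -/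
theorem hcpInt_sqNorm_updiag (i j : Fin 3) (hij : i ≠ j) :
    sqNormInt ((3 • (Pi.single i 1 + Pi.single j 1) : Fin 3 → ℤ) - 3 • (Pi.single i 1 - Pi.single j 1)) = 2 * ((18 : ℕ) : ℤ) := by
  revert hij; revert i j; decide

/-- Integer model: the lower square diagonal `3eᵢ − 3eⱼ`, `3eᵢ + 3eⱼ − 4·(1,1,1)` has `|·|² = 36`. [folklore] -/
theorem hcpInt_sqNorm_lowdiag (i j : Fin 3) (hij : i ≠ j) :
    sqNormInt ((3 • (Pi.single i 1 - Pi.single j 1) : Fin 3 → ℤ) - (3 • (Pi.single i 1 + Pi.single j 1) - (fun _ => 4))) =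
      2 * ((18 : ℕ) : ℤ) := by
  revert hij; revert i j; decide

/-- Membership of a scaled integer vector in the hcp kissing pattern. [folklore] -/
theorem mem_hcp_of_mem_hcpInt {v : Fin 3 → ℤ} (hv : v ∈ hcpInt) :
    ((Real.sqrt ((18 : ℕ) : ℝ))⁻¹ • intVec v : E3) ∈ hcpKissingPattern := by
  simp only [hcpKissingPattern, scaledPattern, Finset.mem_image]
  exact ⟨v, hv, rfl⟩

/-- Coordinate sums of the hcp witnesses. [folklore] -/
theorem hcp_sums (n : E3) (i j : Fin 3) :
    (∑ l : Fin 3, ((3 • (Pi.single i 1 + Pi.single j 1) : Fin 3 → ℤ) l : ℝ) * n l = 3 * (n i + n j)) ∧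
    (∑ l : Fin 3, ((3 • (Pi.single i 1 - Pi.single j 1) : Fin 3 → ℤ) l : ℝ) * n l = 3 * (n i - n j)) ∧
    (∑ l : Fin 3, ((3 • (Pi.single i 1 + Pi.single j 1) - (fun _ => 4) : Fin 3 → ℤ) l : ℝ) * n l =
      3 * (n i + n j) - 4 * (n 0 + n 1 + n 2)) := by
  refine ⟨?_, ?_, ?_⟩
  · simp [Pi.single_apply, add_mul, mul_add, Finset.sum_add_distrib]
  · simp [Pi.single_apply, sub_mul, mul_sub, Finset.sum_sub_distrib]
  · simp [Pi.single_apply, add_mul, sub_mul, mul_add, Finset.sum_add_distrib, Finset.sum_sub_distrib, Fin.sum_univ_three]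
    try ring

/-- `√18 = 3·√2` (with the `ℕ`-cast literal of `scaledPattern`), hence `(√18)⁻¹ · 3 = √2/2`, `(√18)⁻¹ · 6 = √2`,
`(√18)⁻¹ · 4 = (2/3)·√2`. [folklore] -/
theorem sqrt_eighteen_coeffs :
    Real.sqrt ((18 : ℕ) : ℝ) = 3 * Real.sqrt 2 ∧
    (Real.sqrt ((18 : ℕ) : ℝ))⁻¹ * 3 = Real.sqrt 2 / 2 ∧ (Real.sqrt ((18 : ℕ) : ℝ))⁻¹ * 6 = Real.sqrt 2 ∧
      (Real.sqrt ((18 : ℕ) : ℝ))⁻¹ * 4 = 2 / 3 * Real.sqrt 2 := by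
  obtain ⟨ht, -, -, hinv⟩ := sqrt_two_facts
  have h18 : Real.sqrt ((18 : ℕ) : ℝ) = 3 * Real.sqrt 2 := by
    rw [show ((18 : ℕ) : ℝ) = 3 ^ 2 * 2 by norm_num, Real.sqrt_mul (by norm_num), Real.sqrt_sq (by norm_num)]
  rw [h18, mul_inv, hinv]
  refine ⟨rfl, ?_, ?_, ?_⟩
  · ring
  · nlinarith [ht]
  · ring

/-- **hcp witnesses (upper side)** at indices `i ≠ j`: upper cap `√2·nᵢ`, upper-triangle vertex `(nᵢ + nⱼ)/√2`, hexagon vertex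
`(nᵢ − nⱼ)/√2`. [folklore] -/
theorem hcp_witness_up (n : E3) (i j : Fin 3) (hij : i ≠ j) :
    (∃ u ∈ hcpKissingPattern, ∃ v ∈ hcpKissingPattern, dist u v = Real.sqrt 2 ∧ ⟪n, u + v⟫ = Real.sqrt 2 * n i) ∧
    (∃ u ∈ hcpKissingPattern, ⟪n, u⟫ = (n i + n j) / Real.sqrt 2) ∧
    (∃ u ∈ hcpKissingPattern, ⟪n, u⟫ = (n i - n j) / Real.sqrt 2) := by
  obtain ⟨-, c3, c6, -⟩ := sqrt_eighteen_coeffs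
  obtain ⟨-, -, -, hinv⟩ := sqrt_two_facts
  obtain ⟨s1, s2, -⟩ := hcp_sums n i j
  refine ⟨⟨_, mem_hcp_of_mem_hcpInt (hcpInt_tri i j hij), _, mem_hcp_of_mem_hcpInt (hcpInt_hex i j hij),
    (dist_eq_sqrt_two_iff_sqNormInt (by norm_num) _ _).2 (hcpInt_sqNorm_updiag i j hij), ?_⟩,
    ⟨_, mem_hcp_of_mem_hcpInt (hcpInt_tri i j hij), ?_⟩, ⟨_, mem_hcp_of_mem_hcpInt (hcpInt_hex i j hij), ?_⟩⟩
  · rw [inner_add_right, inner_smul_intVec, inner_smul_intVec, s1, s2]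
    rw [show (Real.sqrt ((18 : ℕ) : ℝ))⁻¹ * (3 * (n i + n j)) + (Real.sqrt ((18 : ℕ) : ℝ))⁻¹ * (3 * (n i - n j)) =
      ((Real.sqrt ((18 : ℕ) : ℝ))⁻¹ * 6) * n i by ring, c6]
  · rw [inner_smul_intVec, s1, ← mul_assoc, c3, div_eq_mul_inv _ (Real.sqrt 2), hinv]; ring
  · rw [inner_smul_intVec, s2, ← mul_assoc, c3, div_eq_mul_inv _ (Real.sqrt 2), hinv]; ring

/-- **hcp witnesses (lower side = mirror images)** at indices `i ≠ j`, with `σ = n₀ + n₁ + n₂`: lower cap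
`√2·(nᵢ − 2σ/3)`, lower-triangle vertex `(nᵢ + nⱼ − 4σ/3)/√2`. [folklore] -/
theorem hcp_witness_low (n : E3) (i j : Fin 3) (hij : i ≠ j) :
    (∃ u ∈ hcpKissingPattern, ∃ v ∈ hcpKissingPattern, dist u v = Real.sqrt 2 ∧
      ⟪n, u + v⟫ = Real.sqrt 2 * (n i - 2 * (n 0 + n 1 + n 2) / 3)) ∧
    (∃ u ∈ hcpKissingPattern, ⟪n, u⟫ = (n i + n j - 4 * (n 0 + n 1 + n 2) / 3) / Real.sqrt 2) := by
  obtain ⟨-, c3, c6, c4⟩ := sqrt_eighteen_coeffs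
  obtain ⟨-, -, -, hinv⟩ := sqrt_two_facts
  obtain ⟨-, s2, s3⟩ := hcp_sums n i j
  refine ⟨⟨_, mem_hcp_of_mem_hcpInt (hcpInt_hex i j hij), _, mem_hcp_of_mem_hcpInt (hcpInt_lowtri i j hij),
    (dist_eq_sqrt_two_iff_sqNormInt (by norm_num) _ _).2 (hcpInt_sqNorm_lowdiag i j hij), ?_⟩,
    ⟨_, mem_hcp_of_mem_hcpInt (hcpInt_lowtri i j hij), ?_⟩⟩
  · rw [inner_add_right, inner_smul_intVec, inner_smul_intVec, s2, s3]
    rw [show (Real.sqrt ((18 : ℕ) : ℝ))⁻¹ * (3 * (n i - n j)) +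
        (Real.sqrt ((18 : ℕ) : ℝ))⁻¹ * (3 * (n i + n j) - 4 * (n 0 + n 1 + n 2)) =
      ((Real.sqrt ((18 : ℕ) : ℝ))⁻¹ * 6) * n i - ((Real.sqrt ((18 : ℕ) : ℝ))⁻¹ * 4) * (n 0 + n 1 + n 2) by ring, c6, c4]
    ring
  · rw [inner_smul_intVec, s3]
    rw [show (Real.sqrt ((18 : ℕ) : ℝ))⁻¹ * (3 * (n i + n j) - 4 * (n 0 + n 1 + n 2)) =
      ((Real.sqrt ((18 : ℕ) : ℝ))⁻¹ * 3) * (n i + n j) - ((Real.sqrt ((18 : ℕ) : ℝ))⁻¹ * 4) * (n 0 + n 1 + n 2) by ring, c3, c4,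
      div_eq_mul_inv _ (Real.sqrt 2), hinv]
    ring

/-- **hcp, sorted coordinates**: if `n k ≤ n j ≤ n i` (`i, j, k` distinct) then `n` is direction-covered by the hcp pattern. [this file] -/
theorem hcp_dir_of_order (n : E3) (i j k : Fin 3) (hij : i ≠ j) (hik : i ≠ k)
    (h1 : n i ^ 2 + n j ^ 2 + n k ^ 2 = 1) (hsum : n 0 + n 1 + n 2 = n i + n j + n k)
    (hkj : n k ≤ n j) (hji : n j ≤ n i) : ((∃ u ∈ hcpKissingPattern, ∃ v ∈ hcpKissingPattern, dist u v = Real.sqrt 2 ∧ (57 : ℝ) / 50 ≤ ⟪n, u + v⟫) ∨ (∃ u ∈ hcpKissingPattern, (4 : ℝ) / 5 ≤ ⟪n, u⟫)) := by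
  obtain ⟨ht, htl, -, -⟩ := sqrt_two_facts
  have ht0 : 0 < Real.sqrt 2 := by linarith
  set σ := n 0 + n 1 + n 2 with hσ
  rcases le_total 0 σ with hs | hs
  · -- upper side
    rcases hcp_core hkj hji (by linarith) h1 with hA | hB | hC
    · obtain ⟨⟨u, hu, v, hv, huv, hin⟩, -, -⟩ := hcp_witness_up n i j hij
      exact Or.inl ⟨u, hu, v, hv, huv, by rw [hin]; exact hA⟩
    · obtain ⟨-, ⟨u, hu, hin⟩, -⟩ := hcp_witness_up n i j hij
      refine Or.inr ⟨u, hu, ?_⟩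
      rw [hin, le_div_iff₀ ht0]; linarith
    · obtain ⟨-, -, ⟨u, hu, hin⟩⟩ := hcp_witness_up n i k hik
      refine Or.inr ⟨u, hu, ?_⟩
      rw [hin, le_div_iff₀ ht0]; linarith
  · -- lower side: apply the core to the mirror image `n' = n − (2σ/3)·(1,1,1)`
    have h1' : (n i - 2 * σ / 3) ^ 2 + (n j - 2 * σ / 3) ^ 2 + (n k - 2 * σ / 3) ^ 2 = 1 := by
      have : (n i - 2 * σ / 3) ^ 2 + (n j - 2 * σ / 3) ^ 2 + (n k - 2 * σ / 3) ^ 2 =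
          n i ^ 2 + n j ^ 2 + n k ^ 2 - 4 * σ / 3 * (n i + n j + n k) + 3 * (2 * σ / 3) ^ 2 := by ring
      rw [this, ← hsum, h1]; ring
    rcases hcp_core (p := n i - 2 * σ / 3) (q := n j - 2 * σ / 3) (r := n k - 2 * σ / 3) (by linarith) (by linarith)
        (by linarith) h1' with hA | hB | hC
    · obtain ⟨⟨u, hu, v, hv, huv, hin⟩, -⟩ := hcp_witness_low n i j hij
      exact Or.inl ⟨u, hu, v, hv, huv, by rw [hin]; exact hA⟩
    · obtain ⟨-, ⟨u, hu, hin⟩⟩ := hcp_witness_low n i j hij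
      refine Or.inr ⟨u, hu, ?_⟩
      rw [hin, le_div_iff₀ ht0]; linarith
    · obtain ⟨-, -, ⟨u, hu, hin⟩⟩ := hcp_witness_up n i k hik
      refine Or.inr ⟨u, hu, ?_⟩
      rw [hin, le_div_iff₀ ht0]; linarith

/-- **hcp direction lemma**: every unit vector is direction-covered by the hcp kissing pattern. [this file] -/
theorem hcp_direction (n : E3) (hn : ‖n‖ = 1) : ((∃ u ∈ hcpKissingPattern, ∃ v ∈ hcpKissingPattern, dist u v = Real.sqrt 2 ∧ (57 : ℝ) / 50 ≤ ⟪n, u + v⟫) ∨ (∃ u ∈ hcpKissingPattern, (4 : ℝ) / 5 ≤ ⟪n, u⟫)) := by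
  have hsq := sum_sq_eq_one hn
  rcases le_total (n 0) (n 1) with h01 | h10
  · rcases le_total (n 1) (n 2) with h12 | h21
    · exact hcp_dir_of_order n 2 1 0 (by decide) (by decide) (by linarith) (by ring) h01 h12
    · rcases le_total (n 0) (n 2) with h02 | h20
      · exact hcp_dir_of_order n 1 2 0 (by decide) (by decide) (by linarith) (by ring) h02 h21
      · exact hcp_dir_of_order n 1 0 2 (by decide) (by decide) (by linarith) (by ring) h20 h01
  · rcases le_total (n 1) (n 2) with h12 | h21
    · rcases le_total (n 0) (n 2) with h02 | h20
      · exact hcp_dir_of_order n 2 0 1 (by decide) (by decide) (by linarith) (by ring) h10 h02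
      · exact hcp_dir_of_order n 0 2 1 (by decide) (by decide) (by linarith) (by ring) h12 h20
    · exact hcp_dir_of_order n 0 1 2 (by decide) (by decide) (by linarith) (by ring) h21 h10

end Summit.AtomisticToContinuum.Crystallization.Theorems.OverbindingBudgetTwoShellCoverDirections

end
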